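import Literature.AnabelianGeometry.EtaleTheta.ThetaFrobenioid
import Literature.AnabelianGeometry.EtaleTheta.ThetaFrobenioidOfTempered
import Literature.AnabelianGeometry.EtaleTheta.Discharge.Sec3Example39Base

/-!
# [EtTh] §5 discharge: Proposition 5.1 for the Frobenioid of Example 3.9 (iv), reduced to inputs

Mochizuki, *The étale theta function and its Frobenioid-theoretic manifestations*, Publ. RIMS **45**
(2009), Prop. 5.1 p. 323 (PDF p. 97) [cite: MochizukiEtTh2009, Prop 5.1 p.323 (PDF p.97)]: "The
Frobenioid `C` is a tempered Frobenioid of rationally standard type over a slim base category `D`, whose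
monoid type is `ℤ`, and whose divisor monoid `Φ(−)` is perfect, perf-factorial, non-dilating, and
cuspidally pure. In particular, `C` and the self-equivalence `Ψ : C ⥲ C` satisfy all of the hypotheses
of Corollary 3.8, (i), (ii), (iii); Theorem 4.4", stated in print as following "from Example 3.9,
(iv)" for `C` := "the tempered Frobenioid of monoid type `ℤ`" determined by "the divisor monoid
`Φ := Φ_α^ell` on `D = D_α`" (p. 322 (PDF p. 96)).  abc-iut cell, layer L2, seat abc-iut-L2-t9
(proof-only; node EtTh:Prop5.1 for the Example 3.9 model; continuation of the W2-L2-05 adapter).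

`ThetaFrobenioidOfTempered.lean` (`applicability_of_model`) reduces abc-iut-L2-t4's typing
`ApplicabilityOfGeneralTheory` of Proposition 5.1, for §5 data over the model of ANY tempered Frobenioid
`C₀`, to properties of `C₀`.  Here `C₀ := Example39Data.thetaFrobenioid α h` IS the tempered Frobenioid of
Example 3.9 (iv) (abc-iut-L2-t3, `ThetaFrobenioid.lean`), and two more clauses become theorems:
"perfect" is Example 3.9 (iii)'s `isPerfect` inherited by `Φ_α^ell` (`isPerfect_Φα`), and "over a slim
base category `D`" is `Example39Data.isSlim_Dα` (from `D_W` slim, Remark 3.7.2;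
`Discharge/Sec3Example39Base.lean`).  What remains as input, exactly: the §5 data `𝔉` lying over `C₀`
(`h𝔉`), `Φ_α^ell(X)` integral (`hΦ`, divisoriality), the three vocabulary parameters of
`VocabParams` (rationally standard type; the hypothesis packages of Cor. 3.8 and Thm. 4.4), `D_W` slim,
the monoid type `Λ = ℤ` of the §3 data, non-dilating (found's `IsNonDilatingOn`; Example 3.9 (iii)
records non-dilation in abc-iut-L2-t3's vocabulary `V`, not bridged here), and cuspidal purity (the named
fact `Example39_iv_cuspidallyPure`).

HONEST FRAMING: a reduction over abc-iut-L2-t3's DATA structure `Example39Data` and abc-iut-L2-t4's §5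
DATA; nothing asserts these data exist for an actual curve; typed ≠ proved.
-/

namespace Literature.AnabelianGeometry.EtaleTheta

namespace Example39Data

open CategoryTheory Opposite Literature.AlgebraicGeometry.Frobenioids FrobenioidTheta TemperedFrobenioid

universe u v w

variable {V : FrdIMonoidStub.{w}} {DW : Type u} [Category.{v} DW]
  {TW : RealifiedDivisorMonoids (D₀ := DW) V} (E : Example39Data V DW TW) {A B : DW} (α : A ⟶ B)

/-- **Proposition 5.1 for the tempered Frobenioid `C₀` of Example 3.9 (iv), reduced to its inputs**:
for §5 data `𝔉` whose Frobenioid-level part is that of `C₀ = E.thetaFrobenioid α h`, abc-iut-L2-t4's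
`ApplicabilityOfGeneralTheory 𝔉 (thetaVocab 𝔉 P) Ψ` holds as soon as the listed inputs hold — with
"tempered", "perfect", "perf-factorial" and "slim base" DISCHARGED (by construction, Example 3.9 (iii),
Def. 3.6 (ii), and `isSlim_Dα` from `D_W` slim respectively).
[cite: MochizukiEtTh2009, Prop 5.1 p.323 (PDF p.97)] -/
theorem applicability_of_example39 {VD : FrdICatStub.{max u v, v, w} (Dα α)}
    (h : E.FrobenioidHyp α VD)
    (𝔉 : ThetaFrobenioid.{w} (E.thetaFrobenioid α h).category (Dα α))
    (P : (E.thetaFrobenioid α h).VocabParams)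
    {hΦ : ∀ X : (Dα α)ᵒᵖ, IsIntegral ((E.thetaFrobenioid α h).Φ.carrier X)}
    {IsBFT : MorphismProperty (E.thetaFrobenioid α h).category}
    (h𝔉 : 𝔉.toTemperedFrobenioidStub = (E.thetaFrobenioid α h).thetaStub hΦ IsBFT)
    (Ψ : (E.thetaFrobenioid α h).category ≌ (E.thetaFrobenioid α h).category)
    (hrs : P.IsRationallyStandard) (hW : IsSlim DW) (hZ : TW.Λ = MonoidType.Z)
    (hnd : IsNonDilatingOn (E.thetaFrobenioid α h).divisorMonoid)
    (hcp : E.Example39_iv_cuspidallyPure α h) (h38 : P.HypothesesCor38 Ψ)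
    (h44 : P.HypothesesThm44 Ψ) :
    FrobenioidThetaBiKummer.ApplicabilityOfGeneralTheory 𝔉 (thetaVocab 𝔉 P) Ψ :=
  applicability_of_model 𝔉 P h𝔉 Ψ hrs (isSlim_Dα α hW) hZ (E.isPerfect_Φα α) hnd hcp h38 h44

/-- The **"slim base"** clause of Proposition 5.1's vocabulary for any §5 data over `D_α` holds when `D_W`
is slim. [cite: MochizukiEtTh2009, Prop 5.1 p.323 (PDF p.97)] -/
theorem thetaVocab_isSlimBase {VD : FrdICatStub.{max u v, v, w} (Dα α)} (h : E.FrobenioidHyp α VD)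
    (𝔉 : ThetaFrobenioid.{w} (E.thetaFrobenioid α h).category (Dα α))
    (P : (E.thetaFrobenioid α h).VocabParams) (hW : IsSlim DW) : (thetaVocab 𝔉 P).IsSlimBase :=
  isSlim_Dα α hW

/-- The **"perfect"** clause of Proposition 5.1's vocabulary for §5 data over the Example 3.9 Frobenioid
holds outright (Example 3.9 (iii): `Φ_W^ell` is perfect, inherited by `Φ_α^ell`).
[cite: MochizukiEtTh2009, Prop 5.1 p.323 (PDF p.97)] -/
theorem thetaVocab_isPerfect {VD : FrdICatStub.{max u v, v, w} (Dα α)} (h : E.FrobenioidHyp α VD)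
    (𝔉 : ThetaFrobenioid.{w} (E.thetaFrobenioid α h).category (Dα α))
    (P : (E.thetaFrobenioid α h).VocabParams) : (thetaVocab 𝔉 P).IsPerfect :=
  E.isPerfect_Φα α

/-- The **"perf-factorial"** clause likewise holds outright (Def. 3.6 (ii) / Example 3.9 (iii)).
[cite: MochizukiEtTh2009, Prop 5.1 p.323 (PDF p.97)] -/
theorem thetaVocab_isPerfFactorial {VD : FrdICatStub.{max u v, v, w} (Dα α)}
    (h : E.FrobenioidHyp α VD)
    (𝔉 : ThetaFrobenioid.{w} (E.thetaFrobenioid α h).category (Dα α))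
    (P : (E.thetaFrobenioid α h).VocabParams) : (thetaVocab 𝔉 P).IsPerfFactorial :=
  (E.thetaFrobenioid α h).isPerfFactorial

/-- The **"cuspidally pure"** clause is literally abc-iut-L2-t3's named fact `Example39_iv_cuspidallyPure`
(bookkeeping). [cite: MochizukiEtTh2009, Prop 5.1 p.323 (PDF p.97)] -/
theorem thetaVocab_isCuspidallyPure_iff {VD : FrdICatStub.{max u v, v, w} (Dα α)}
    (h : E.FrobenioidHyp α VD) (𝔉 : ThetaFrobenioid.{w} (E.thetaFrobenioid α h).category (Dα α))
    (P : (E.thetaFrobenioid α h).VocabParams) :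
    (thetaVocab 𝔉 P).IsCuspidallyPure ↔ E.Example39_iv_cuspidallyPure α h :=
  Iff.rfl

end Example39Data

end Literature.AnabelianGeometry.EtaleTheta
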